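import Mathlib
import Literature.NumberTheory.Transcendental.KZCalculus

/-!
# `LegendreCubicForm` (stmt-KontsevichZagierPeriods-3521), line `Sketch (hat-box chart)`: stub `stub_hatBoxImage`

Pure real algebra: the hat-box change of variables
`Λ(λ, μ) = (u, z)`, `u = √((e₃−e₁)(e₂−λ)(μ−e₂)/((e₃−e₂)(λ−e₁)(μ−e₁)))`,
`z = √((e₃−λ)(e₃−μ)/((e₃−e₁)(e₃−e₂)))`, maps the open period rectangle `(e₁,e₂) × (e₂,e₃)` ONTO the
open half-strip `{0 < u} × {0 < z < 1}`.

Proof. (⊆) every factor is positive on the rectangle, and `(e₃−λ)(e₃−μ) < (e₃−e₁)(e₃−e₂)`.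
(⊇) given `u > 0`, `0 < z < 1` put `x₁² = (1−z²)/(1+u²)`, `x₂² = u²x₁²`, `x₃² = z²` (positive, sum `1`)
and let `λ < μ` be the two roots of the monic quadratic
`q(θ) = x₁²(θ−e₂)(θ−e₃) + x₂²(θ−e₁)(θ−e₃) + x₃²(θ−e₁)(θ−e₂) = θ² − Sθ + P`; the signs
`q(e₁) > 0 > q(e₂)`, `q(e₃) > 0` locate `e₁ < λ < e₂ < μ < e₃`, and `q(eᵢ) = (eᵢ−λ)(eᵢ−μ)` returns
exactly `u²` and `z²` for the two radicands. No definitions are introduced.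
References: Kontsevich–Zagier 2001 §1.2 (rule (2), change of variables); Archimedes' hat-box theorem.
-/

noncomputable section

namespace Summit.KontsevichZagierPeriods.UnfoldedStokes.LegendreCubicFormLine

open Set MeasureTheory
open Literature.NumberTheory.Transcendental

/-- Forward inclusion, pointwise: on the rectangle `a < l < b < m < c` the hat-box coordinates satisfy
`u > 0` and `0 < z < 1`. -/
theorem hatBoxImage_fwd {a b c l m : ℝ} (hal : a < l) (hlb : l < b) (hbm : b < m) (hmc : m < c) :
    0 < Real.sqrt ((c - a) * (b - l) * (m - b) / ((c - b) * (l - a) * (m - a))) ∧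
      0 < Real.sqrt ((c - l) * (c - m) / ((c - a) * (c - b))) ∧
      Real.sqrt ((c - l) * (c - m) / ((c - a) * (c - b))) < 1 := by
  have hca : 0 < c - a := by linarith
  have hcb : 0 < c - b := by linarith
  have hbl : 0 < b - l := by linarith
  have hmb : 0 < m - b := by linarith
  have hla : 0 < l - a := by linarith
  have hma : 0 < m - a := by linarith
  have hcl : 0 < c - l := by linarith
  have hcm : 0 < c - m := by linarith
  refine ⟨Real.sqrt_pos.mpr (div_pos (mul_pos (mul_pos hca hbl) hmb) (mul_pos (mul_pos hcb hla) hma)),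
    Real.sqrt_pos.mpr (div_pos (mul_pos hcl hcm) (mul_pos hca hcb)), ?_⟩
  rw [Real.sqrt_lt' one_pos, one_pow, div_lt_one (mul_pos hca hcb)]
  linarith only [mul_pos hcl hmb, mul_pos hla hcm, mul_pos hla hmb]

/-- The explicit inverse (root location). For `a < b < c`, `u > 0` and `0 < z < 1` there are
`a < l < b < m < c` — the two roots of `q(θ) = x₁²(θ−b)(θ−c) + u²x₁²(θ−a)(θ−c) + z²(θ−a)(θ−b)` with
`x₁² = (1−z²)/(1+u²)` — whose hat-box coordinates are exactly `(u, z)`. -/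
theorem hatBoxImage_inverse {a b c u z : ℝ} (hab : a < b) (hbc : b < c) (hu : 0 < u) (hz0 : 0 < z)
    (hz1 : z < 1) :
    ∃ l m : ℝ, a < l ∧ l < b ∧ b < m ∧ m < c ∧
      Real.sqrt ((c - a) * (b - l) * (m - b) / ((c - b) * (l - a) * (m - a))) = u ∧
      Real.sqrt ((c - l) * (c - m) / ((c - a) * (c - b))) = z := by
  have hca : 0 < c - a := by linarith
  have hcb : 0 < c - b := by linarith
  have hba : 0 < b - a := by linarith
  have hz2 : z ^ 2 < 1 := pow_lt_one₀ hz0.le hz1 two_ne_zero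
  have h1u : (1 + u ^ 2 : ℝ) ≠ 0 := by positivity
  -- the weight `x₁² = (1 - z²)/(1 + u²)`; the other two weights are `u² x₁²` and `z²`
  obtain ⟨p, hp⟩ : ∃ p : ℝ, p = (1 - z ^ 2) / (1 + u ^ 2) := ⟨_, rfl⟩
  have hppos : 0 < p := by rw [hp]; exact div_pos (by linarith) (by positivity)
  have hkey : p * (1 + u ^ 2) = 1 - z ^ 2 := by rw [hp]; exact div_mul_cancel₀ _ h1u
  have hsum : p + u ^ 2 * p + z ^ 2 = 1 := by linear_combination hkey
  -- Vieta data of the monic quadratic `q(θ) = θ² - S θ + P`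
  obtain ⟨S, hS⟩ : ∃ S : ℝ, S = p * (b + c) + u ^ 2 * p * (a + c) + z ^ 2 * (a + b) := ⟨_, rfl⟩
  obtain ⟨P, hP⟩ : ∃ P : ℝ, P = p * (b * c) + u ^ 2 * p * (a * c) + z ^ 2 * (a * b) := ⟨_, rfl⟩
  have hqa : a ^ 2 - S * a + P = p * ((a - b) * (a - c)) := by
    rw [hS, hP]; linear_combination (-1 : ℝ) * a ^ 2 * hsum
  have hqb : b ^ 2 - S * b + P = u ^ 2 * p * ((b - a) * (b - c)) := by
    rw [hS, hP]; linear_combination (-1 : ℝ) * b ^ 2 * hsum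
  have hqc : c ^ 2 - S * c + P = z ^ 2 * ((c - a) * (c - b)) := by
    rw [hS, hP]; linear_combination (-1 : ℝ) * c ^ 2 * hsum
  -- signs of `q` at the three branch points
  have hsa : 0 < p * ((a - b) * (a - c)) :=
    mul_pos hppos (mul_pos_of_neg_of_neg (by linarith) (by linarith))
  have hsb : u ^ 2 * p * ((b - a) * (b - c)) < 0 :=
    mul_neg_of_pos_of_neg (mul_pos (pow_pos hu 2) hppos) (mul_neg_of_pos_of_neg hba (by linarith))
  have hsc : 0 < z ^ 2 * ((c - a) * (c - b)) := mul_pos (pow_pos hz0 2) (mul_pos hca hcb)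
  -- positive discriminant (a monic quadratic negative at `b`)
  have hD : 0 < S ^ 2 - 4 * P := by linarith only [sq_nonneg (S - 2 * b), hqb, hsb]
  obtain ⟨r, hr⟩ : ∃ r : ℝ, r = Real.sqrt (S ^ 2 - 4 * P) := ⟨_, rfl⟩
  have hrpos : 0 < r := by rw [hr]; exact Real.sqrt_pos.mpr hD
  have hr2 : r ^ 2 = S ^ 2 - 4 * P := by rw [hr]; exact Real.sq_sqrt hD.le
  -- the two roots
  obtain ⟨l, hl⟩ : ∃ l : ℝ, l = (S - r) / 2 := ⟨_, rfl⟩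
  obtain ⟨m, hm⟩ : ∃ m : ℝ, m = (S + r) / 2 := ⟨_, rfl⟩
  have hlm : l < m := by rw [hl, hm]; linarith
  have hfa : (a - l) * (a - m) = p * ((a - b) * (a - c)) := by
    rw [hl, hm]; linear_combination hqa + (-1 / 4 : ℝ) * hr2
  have hfb : (b - l) * (b - m) = u ^ 2 * p * ((b - a) * (b - c)) := by
    rw [hl, hm]; linear_combination hqb + (-1 / 4 : ℝ) * hr2
  have hfc : (c - l) * (c - m) = z ^ 2 * ((c - a) * (c - b)) := by
    rw [hl, hm]; linear_combination hqc + (-1 / 4 : ℝ) * hr2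
  -- root location
  have hbm : b < m := by
    by_contra h
    have h1 : 0 ≤ b - m := by linarith
    have h2 : 0 ≤ b - l := by linarith
    linarith only [mul_nonneg h2 h1, hfb, hsb]
  have hlb : l < b := by
    by_contra h
    have h1 : 0 ≤ l - b := by linarith
    have h2 : 0 ≤ m - b := by linarith
    linarith only [mul_nonneg h1 h2, hfb, hsb]
  have hal : a < l := by
    by_contra h
    have h1 : 0 ≤ a - l := by linarith
    have h2 : 0 ≤ m - a := by linarith
    linarith only [mul_nonneg h1 h2, hfa, hsa]
  have hmc : m < c := by
    by_contra h
    have h1 : 0 ≤ m - c := by linarith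
    have h2 : 0 ≤ c - l := by linarith
    linarith only [mul_nonneg h2 h1, hfc, hsc]
  have hla : 0 < l - a := by linarith
  have hma : 0 < m - a := by linarith
  -- the two radicands are `u²` and `z²`
  have hradu : (c - a) * (b - l) * (m - b) / ((c - b) * (l - a) * (m - a)) = u ^ 2 := by
    rw [div_eq_iff (mul_pos (mul_pos hcb hla) hma).ne']
    linear_combination (-(c - a)) * hfb - u ^ 2 * (c - b) * hfa
  have hradz : (c - l) * (c - m) / ((c - a) * (c - b)) = z ^ 2 := by
    rw [div_eq_iff (mul_pos hca hcb).ne', hfc]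
  refine ⟨l, m, hal, hlb, hbm, hmc, ?_, ?_⟩
  · rw [hradu, Real.sqrt_sq hu.le]
  · rw [hradz, Real.sqrt_sq hz0.le]

/-- **Stub `stub_hatBoxImage`** of line `Sketch (hat-box chart)` (crux stmt-KontsevichZagierPeriods-3521,
`LegendreCubicForm`): the hat-box map sends the open period rectangle `(e₁,e₂) × (e₂,e₃)` ONTO the open
half-strip `(0,∞) × (0,1)`: for `(u,z)` in the half-strip, `λ < μ` are the two roots of
`q(θ) = Σ xᵢ² ∏_{j≠i}(θ−eⱼ)` with `x₁² = (1−z²)/(1+u²)`, `x₂² = u²x₁²`, `x₃² = z²`, located by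
`q(e₁) > 0 > q(e₂)`, `q(e₃) > 0`. [folklore] -/
theorem stub_hatBoxImage :
    ∀ (e₁ e₂ e₃ : ℚ), e₁ < e₂ → e₂ < e₃ →
      (fun x : Fin 2 → ℝ => (![Real.sqrt (((e₃ : ℝ) - (e₁ : ℝ)) * ((e₂ : ℝ) - x 0) * (x 1 - (e₂ : ℝ)) / (((e₃ : ℝ) - (e₂ : ℝ)) * (x 0 - (e₁ : ℝ)) * (x 1 - (e₁ : ℝ)))), Real.sqrt (((e₃ : ℝ) - x 0) * ((e₃ : ℝ) - x 1) / (((e₃ : ℝ) - (e₁ : ℝ)) * ((e₃ : ℝ) - (e₂ : ℝ))))] : Fin 2 → ℝ)) ''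
          {x : Fin 2 → ℝ | (e₁ : ℝ) < x 0 ∧ x 0 < (e₂ : ℝ) ∧ (e₂ : ℝ) < x 1 ∧ x 1 < (e₃ : ℝ)} =
        {w : Fin 2 → ℝ | 0 < w 0 ∧ 0 < w 1 ∧ w 1 < 1} := by
  intro e₁ e₂ e₃ h12 h23
  have hab : (e₁ : ℝ) < (e₂ : ℝ) := by exact_mod_cast h12
  have hbc : (e₂ : ℝ) < (e₃ : ℝ) := by exact_mod_cast h23
  refine Set.Subset.antisymm ?_ ?_
  · rintro _ ⟨x, hx, rfl⟩
    obtain ⟨h1, h2, h3, h4⟩ := hx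
    simp only [Set.mem_setOf_eq, Matrix.cons_val_zero, Matrix.cons_val_one]
    exact hatBoxImage_fwd h1 h2 h3 h4
  · intro w hw
    obtain ⟨hu, hz0, hz1⟩ := hw
    obtain ⟨l, m, hal, hlb, hbm, hmc, hU, hZ⟩ := hatBoxImage_inverse hab hbc hu hz0 hz1
    refine ⟨![l, m], ?_, ?_⟩
    · simp only [Set.mem_setOf_eq, Matrix.cons_val_zero, Matrix.cons_val_one]
      exact ⟨hal, hlb, hbm, hmc⟩
    · funext i
      fin_cases i
      · simpa using hU
      · simpa using hZ

end Summit.KontsevichZagierPeriods.UnfoldedStokes.LegendreCubicFormLine
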